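import Summits.CriticalPhenomena.SAWScalingLimit.Theses.SAWLoopFugacityFlow
import Summits.CriticalPhenomena.SAWScalingLimit.Theorems.IsingBoundaryRatio.Negative.IsingBoundaryRatioNormalisation
import Literature.Probability.RandomPlanarGeometry.SLEExistenceNeEightHolds
import Literature.Probability.RandomPlanarGeometry.SLEConvergenceCriterion
import Literature.Probability.RandomPlanarGeometry.SelfAvoidingWalkProofs

/-!
# `SAWLoopFugacityFlow.Assembly` (stmt-CriticalPhenomena-10724): the restriction tail — proved

Route `SAWLoopFugacityFlow` of `CriticalPhenomena/SAWScalingLimit` (assembly item, shared verbatim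
with route `SAWSteinDefect`):

`SLECarrier → SLEAvoidanceValue → AvoidanceLimit → EventualTight → SimpleSubseqLimits →
 AvoidancePassage → AvoidanceDeterminesLaw → SAWScalingLimit`.

This is the soft "identification + Prokhorov" end of the Lawler–Schramm–Werner programme for the
planar self-avoiding walk (LSW 2004, §3.4.2 and Prediction 1 of §4.1; LSW 2003, §3 and Thm. 6.1;
Billingsley 1999, Thm. 5.1 and its Corollary), with every analytic input taken as a hypothesis
(the route items) and every "known" input taken from THEOREMS of the tree:

* the chordal SLE_{8/3} law of a Dobrushin domain exists (`exists_isSLECurve_eightThirds`,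
  Rohde–Schramm);
* chordal uniformizing maps exist (`MarkedDomain.exists_isChordalUniformizing_holds`,
  Riemann–Carathéodory), hull subdomains pull back to `*`-hulls (`IsStarHull.pullbackHull`) and
  `*`-hulls carry restriction data `(Φ_A, Φ'_A(0))`
  (`IsStarHull.existsUnique_isRestrictionMap_holds`, `IsStarHull.exists_hasRestrictionDeriv_holds`);
* Prokhorov's theorem on the Polish space `CurveClass ℂ` (Mathlib's
  `isCompact_closure_of_isTightMeasureSet`).

## Proof

Fix `(D; a, b)` and an endpoint approximation; let `P_δ` be the critical SAW law pushed to
`CurveClass ℂ` and `μ` the chordal SLE_{8/3} law of `D`.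

1. `P_δ` is a probability measure for all small `δ > 0` (`eventually_isProbabilityMeasure_law`:
   the endpoints are joined in `Ω_δ`, so a SAW exists and the partition function is positive,
   `x_c > 0`; it is finite because `Ω_δ` is finite, `finite_domainSAW`).
2. (Prokhorov, `exists_subseq`) `EventualTight` makes `{P_δ : δ ∈ (0, δ₀]}` tight, so every mesh
   sequence `s_n → 0⁺` has a subsequence along which `P_{s_n} ⇒ ν`, a probability measure.
3. (Identification, `subseqLimit_eq`) For every hull subdomain `D'` restriction data exist
   (`exists_restrictionData`), so `AvoidanceLimit` (pulled along `s_n`) and `SLEAvoidanceValue`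
   give `P_{s_n}(γ ⊆ cl D') → μ(γ ⊆ cl D')`; `AvoidancePassage` transfers these values to `ν`;
   `SimpleSubseqLimits` and `SLECarrier` supply the carriers; `AvoidanceDeterminesLaw` gives
   `ν = μ`.
4. The subsequence principle along the countably generated filter `𝓝[>] 0`
   (`Filter.tendsto_of_subseq_tendsto`) gives `P_δ ⇒ μ`, i.e. `ConvergesInLawToSLE (8/3) D`.

## References

* G. F. Lawler, O. Schramm, W. Werner, *Conformal restriction: the chordal case*, J. Amer. Math.
  Soc. 16 (2003), §3 and Thm. 6.1.
* G. F. Lawler, O. Schramm, W. Werner, *On the scaling limit of planar self-avoiding walk*, Proc.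
  Sympos. Pure Math. 72 (2004), §3.4.2 and §4.1, Prediction 1.
* P. Billingsley, *Convergence of Probability Measures*, 2nd ed. (1999), Thm. 5.1 and Corollary.
-/

noncomputable section

open MeasureTheory Filter Topology Set
open scoped NNReal ENNReal BoundedContinuousFunction
open Literature.Probability Literature.Probability.LatticeModels
  Literature.Probability.RandomPlanarGeometry
open UpperHalfPlane (upperHalfPlaneSet)
open Summit.CriticalPhenomena.SAWScalingLimit.Theses.SAWLoopFugacityFlow

namespace Summit.CriticalPhenomena.SAWScalingLimit.Theorems

namespace SAWLoopFugacityFlowAssembly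

/-! ### Step 1: the critical SAW law is eventually a probability measure -/

/-- The vertices of a walk of `Ω_δ` are its starting point or sites of `Ω_δ` (every edge of
`discreteDomainGraph Ω δ` joins two sites of `meshDomain Ω δ`). [folklore] -/
theorem mem_support_walk {Ω : Set ℂ} {δ : ℝ} {u v : Site 2}
    (p : (discreteDomainGraph Ω δ).Walk u v) :
    ∀ w ∈ p.support, w = u ∨ w ∈ meshDomain Ω δ := by
  induction p with
  | nil =>
    intro w hw
    rw [SimpleGraph.Walk.support_nil, List.mem_singleton] at hw
    exact Or.inl hw
  | cons h p ih =>
    intro w hw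
    rw [SimpleGraph.Walk.support_cons, List.mem_cons] at hw
    rcases hw with rfl | hw
    · exact Or.inl rfl
    · rcases ih w hw with rfl | hw'
      · exact Or.inr (discreteDomainGraph_adj_iff.1 h).2.2
      · exact Or.inr hw'

/-- The support of a SAW of `Ω_δ` determines it. [folklore] -/
theorem walk_support_injective {Ω : Set ℂ} {δ : ℝ} {u v : Site 2} :
    Function.Injective fun γ : SAW.DomainSAW Ω δ u v => γ.walk.support := by
  rintro ⟨p, hp⟩ ⟨q, hq⟩ h
  simp only at h
  have := SimpleGraph.Walk.support_injective h
  subst this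
  rfl

-- adapted from Literature/Barriers/CriticalPhenomena/SupercriticalSAWSpaceFillingFilamentsCusp.lean
-- (`finite_domainSAW_of_isBounded`), with the hypothesis `u ∈ Ω_δ` removed.
/-- For a bounded domain and a positive mesh there are finitely many SAWs of `Ω_δ` between two
given sites: their supports are duplicate-free lists over the finite set `{u} ∪ Ω_δ`.
[folklore] -/
theorem finite_domainSAW {Ω : Set ℂ} {δ : ℝ} (hΩ : Bornology.IsBounded Ω) (hδ : 0 < δ)
    (u v : Site 2) : Finite (SAW.DomainSAW Ω δ u v) := by
  classical
  set S : Set (Site 2) := insert u (meshDomain Ω δ) with hSdef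
  have hfin : S.Finite := (meshDomain_finite hΩ hδ).insert u
  haveI : Fintype ↥S := hfin.fintype
  have hsupp : ∀ (γ : SAW.DomainSAW Ω δ u v), ∀ w ∈ γ.walk.support, w ∈ S := by
    intro γ w hw
    rcases mem_support_walk γ.walk w hw with rfl | h
    · exact Set.mem_insert _ _
    · exact Set.mem_insert_of_mem _ h
  let f : SAW.DomainSAW Ω δ u v → {l : List ↥S // l.length ≤ Fintype.card ↥S} :=
    fun γ => ⟨γ.walk.support.pmap (fun w hw => ⟨w, hw⟩) (hsupp γ), by
      rw [List.length_pmap]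
      have hnd : (γ.walk.support.pmap (fun w hw => (⟨w, hw⟩ : ↥S)) (hsupp γ)).Nodup := by
        refine List.Nodup.pmap ?_ γ.isPath.support_nodup
        intro a ha b hb h
        exact congrArg Subtype.val h
      have := hnd.length_le_card
      rwa [List.length_pmap] at this⟩
  haveI : Finite {l : List ↥S // l.length ≤ Fintype.card ↥S} :=
    (List.finite_length_le _ _).to_subtype
  refine Finite.of_injective f fun γ γ' h => ?_
  apply walk_support_injective
  have h' :=
    congrArg (fun l : {l : List ↥S // l.length ≤ Fintype.card ↥S} => l.1.map Subtype.val) h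
  simpa [f, List.map_pmap] using h'

/-- The critical SAW partition function of `Ω_δ` is finite once there are finitely many SAWs.
[folklore] -/
theorem weight_univ_ne_top {Ω : Set ℂ} {δ : ℝ} {u v : Site 2}
    [Finite (SAW.DomainSAW Ω δ u v)] : SAW.weight Ω δ u v univ ≠ ⊤ := by
  classical
  haveI : Fintype (SAW.DomainSAW Ω δ u v) := Fintype.ofFinite _
  rw [SAW.weight, Measure.sum_apply _ MeasurableSet.univ, tsum_fintype]
  refine ENNReal.sum_ne_top.2 fun γ _ => ?_
  simp

/-- The critical SAW partition function is positive as soon as one SAW exists (`x_c > 0`).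
[folklore] -/
theorem weight_univ_ne_zero {Ω : Set ℂ} {δ : ℝ} {u v : Site 2}
    (γ₀ : SAW.DomainSAW Ω δ u v) : SAW.weight Ω δ u v univ ≠ 0 := by
  intro h0
  have h1 : SAW.weight Ω δ u v {γ₀} ≤ SAW.weight Ω δ u v univ :=
    measure_mono (subset_univ _)
  rw [h0, SAW.weight_singleton, nonpos_iff_eq_zero, ENNReal.ofReal_eq_zero] at h1
  exact absurd h1 (not_le.2 (pow_pos SAW.criticalFugacity_pos_lt_one'.1 _))

/-- With finitely many SAWs and at least one, the critical SAW law `P_δ ∝ x_c^{|γ|}` is a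
probability measure. [folklore] -/
theorem isProbabilityMeasure_law {Ω : Set ℂ} {δ : ℝ} {u v : Site 2}
    [Finite (SAW.DomainSAW Ω δ u v)] (γ₀ : SAW.DomainSAW Ω δ u v) :
    IsProbabilityMeasure (SAW.law Ω δ u v) :=
  ⟨by rw [SAW.law, Measure.smul_apply, smul_eq_mul,
    ENNReal.inv_mul_cancel (weight_univ_ne_zero γ₀) weight_univ_ne_top]⟩

/-- Under an endpoint approximation the critical SAW law of `(Ω_δ; a_δ, b_δ)` is a probability
measure for all small `δ > 0` (the endpoints are joined in `Ω_δ`, and `Ω_δ` is finite).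
[folklore] -/
theorem eventually_isProbabilityMeasure_law {D : DobrushinDomain} {a b : ℝ → Site 2}
    (h : SAW.IsEndpointApprox D a b) :
    ∀ᶠ δ in 𝓝[>] (0 : ℝ), IsProbabilityMeasure (SAW.law D.carrier δ (a δ) (b δ)) := by
  classical
  filter_upwards [h.reachable, self_mem_nhdsWithin] with δ hr hδ
  haveI := finite_domainSAW D.isBounded (Set.mem_Ioi.1 hδ) (a δ) (b δ)
  obtain ⟨p⟩ := hr
  exact isProbabilityMeasure_law ⟨p.toPath, p.toPath.2⟩

/-! ### Step 2: restriction data exist for every hull subdomain -/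

/-- For a subdomain `D' ⊆ D` with the same marked points agreeing with `D` near them, there are a
chordal uniformizing map `φ` of `(D; a, b)` and restriction data `(Φ, d)` of the pulled-back hull
`A = closure (ℍ ∖ φ⁻¹(D'))` — all from theorems of the tree (Riemann–Carathéodory,
`IsStarHull.pullbackHull`, [LSW] §2).
[cite: LawlerSchrammWerner2003Restriction, §2 pp. 7–8 (g_A, Φ_A)] -/
theorem exists_restrictionData (D D' : DobrushinDomain) (hsub : D'.carrier ⊆ D.carrier)
    (h0 : D'.pt 0 = D.pt 0) (h1 : D'.pt 1 = D.pt 1)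
    (hε : ∃ ε : ℝ, 0 < ε ∧
      D'.carrier ∩ Metric.ball (D.pt 0) ε = D.carrier ∩ Metric.ball (D.pt 0) ε ∧
      D'.carrier ∩ Metric.ball (D.pt 1) ε = D.carrier ∩ Metric.ball (D.pt 1) ε) :
    ∃ φ : ConformalEquiv upperHalfPlaneSet D.carrier, D.IsChordalUniformizing φ ∧
      ∃ (Φ : ConformalEquiv (upperHalfPlaneSet \
          closure (upperHalfPlaneSet \ {z | z ∈ upperHalfPlaneSet ∧ φ z ∈ D'.carrier}))
          upperHalfPlaneSet) (d : ℝ),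
        IsRestrictionMap
          (closure (upperHalfPlaneSet \ {z | z ∈ upperHalfPlaneSet ∧ φ z ∈ D'.carrier})) Φ ∧
        HasRestrictionDeriv
          (closure (upperHalfPlaneSet \ {z | z ∈ upperHalfPlaneSet ∧ φ z ∈ D'.carrier})) Φ
          d := by
  obtain ⟨φ, hφ⟩ := MarkedDomain.exists_isChordalUniformizing_holds D
  have hHull : D.IsHullSubdomain D' :=
    IsingBoundaryRatio.Negative.isHullSubdomain_of_conds hsub h0 h1 hε
  have hstar : IsStarHull (φ.pullbackHull D') :=
    IsStarHull.pullbackHull JordanDomain.isSimplyConnected_holds hφ hHull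
  obtain ⟨Φ, hΦ, -⟩ := IsStarHull.existsUnique_isRestrictionMap_holds hstar
  obtain ⟨d, -, -, hd⟩ := IsStarHull.exists_hasRestrictionDeriv_holds hstar hΦ
  exact ⟨φ, hφ, Φ, d, hΦ, hd⟩

/-! ### Step 3: identification of subsequential limits -/

/-- **Identification.** Under the route items `SLECarrier`, `SLEAvoidanceValue`, `AvoidanceLimit`,
`SimpleSubseqLimits`, `AvoidancePassage`, `AvoidanceDeterminesLaw`: every probability measure `ν`
which is the weak limit of the pushed-forward critical SAW laws along a mesh sequence `s_n → 0⁺`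
is the chordal SLE_{8/3} law `μ` of `(D; a, b)` (LSW 2003 §3: the law of a restriction-type
random simple chord is determined by its hull-avoidance probabilities, here `Φ'_A(0)^{5/8}`).
[cite: LawlerSchrammWerner2003Restriction, §3 and Thm. 6.1] -/
theorem subseqLimit_eq (hCar : SLECarrier) (hVal : SLEAvoidanceValue) (hA : AvoidanceLimit)
    (hS : SimpleSubseqLimits) (hPass : AvoidancePassage) (hDet : AvoidanceDeterminesLaw)
    {D : DobrushinDomain} {a b : ℝ → Site 2} (happ : SAW.IsEndpointApprox D a b)
    {μ : Measure (CurveClass ℂ)} (hμ : IsSLELaw ((8 : ℝ≥0) / 3) D μ)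
    {s : ℕ → ℝ} (hs : Tendsto s atTop (𝓝[>] (0 : ℝ)))
    {ν : Measure (CurveClass ℂ)} (hν : IsProbabilityMeasure ν)
    (hlim : ∀ f : CurveClass ℂ →ᵇ ℝ, Tendsto
      (fun n ↦ ∫ γ, f γ.curve ∂(SAW.law D.carrier (s n) (a (s n)) (b (s n)))) atTop
      (𝓝 (∫ x, f x ∂ν))) :
    ν = μ := by
  -- carriers
  obtain ⟨hμP, hcarμ⟩ := hCar D μ hμ
  have hcarν := hS D a b happ s ν hs hν hlim
  -- avoidance values of `ν`
  have hpass := hPass D a b happ s ν μ hs hν hlim hμ (fun D' hsub h0 h1 hε ↦ by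
    obtain ⟨φ, hφ, Φ, d, hΦ, hd⟩ := exists_restrictionData D D' hsub h0 h1 hε
    have hlimA := hA D D' a b happ hsub h0 h1 hε φ hφ _ rfl Φ d hΦ hd
    have hval := hVal D D' μ hμ hsub h0 h1 hε φ hφ _ rfl Φ d hΦ hd
    rw [hval]
    exact hlimA.comp hs)
  -- avoidance determines the law
  exact (hDet D μ ν hμP hν hcarμ hcarν
    (fun D' hsub h0 h1 hε ↦ (hpass D' hsub h0 h1 hε).symm)).symm

/-! ### Step 4: Prokhorov along a mesh sequence -/

/-- **Prokhorov along the mesh for the critical SAW laws.** Under `EventualTight`, along every mesh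
sequence `s_n → 0⁺` some subsequence of the pushed-forward critical SAW laws converges weakly to a
probability measure on `CurveClass ℂ` (Billingsley 1999, Thm. 5.1; Mathlib's
`isCompact_closure_of_isTightMeasureSet` on the Polish space `CurveClass ℂ`, after discarding the
finitely many initial meshes at which the law is not yet a probability measure).
[cite: BillingsleyCPM1999, Thm. 5.1] -/
theorem exists_subseq (hT : EventualTight) {D : DobrushinDomain} {a b : ℝ → Site 2}
    (happ : SAW.IsEndpointApprox D a b) {s : ℕ → ℝ} (hs : Tendsto s atTop (𝓝[>] (0 : ℝ))) :
    ∃ (φ : ℕ → ℕ) (ν : Measure (CurveClass ℂ)), StrictMono φ ∧ IsProbabilityMeasure ν ∧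
      ∀ f : CurveClass ℂ →ᵇ ℝ, Tendsto
        (fun n ↦ ∫ γ, f γ.curve ∂(SAW.law D.carrier (s (φ n)) (a (s (φ n))) (b (s (φ n)))))
        atTop (𝓝 (∫ x, f x ∂ν)) := by
  obtain ⟨δ₀, hδ₀, htight⟩ := hT D a b happ
  -- eventually along `s`: probability measures, and meshes in `(0, δ₀]`
  have h1 : ∀ᶠ n in atTop, IsProbabilityMeasure (SAW.law D.carrier (s n) (a (s n)) (b (s n))) :=
    hs.eventually (eventually_isProbabilityMeasure_law happ)
  have h2 : ∀ᶠ n in atTop, s n ∈ Set.Ioc 0 δ₀ := hs.eventually (Ioc_mem_nhdsGT hδ₀)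
  obtain ⟨N, hN⟩ := eventually_atTop.1 (h1.and h2)
  have hprob : ∀ n, IsProbabilityMeasure (SAW.law D.carrier (s (n + N)) (a (s (n + N)))
      (b (s (n + N)))) := fun n ↦ (hN _ (N.le_add_left n)).1
  have hmeas : ∀ n, AEMeasurable (fun γ : SAW.DomainSAW D.carrier (s n) (a (s n)) (b (s n)) ↦
      γ.curve) (SAW.law D.carrier (s n) (a (s n)) (b (s n))) := fun n ↦
    SAW.aemeasurable_curve _ _ _ _
  -- the laws, as probability measures on the curve space
  let ν : ℕ → ProbabilityMeasure (CurveClass ℂ) := fun n ↦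
    ⟨(SAW.law D.carrier (s (n + N)) (a (s (n + N))) (b (s (n + N)))).map (fun γ ↦ γ.curve), by
      haveI := hprob n
      exact Measure.isProbabilityMeasure_map (hmeas (n + N))⟩
  have htight' : IsTightMeasureSet
      {((ρ : ProbabilityMeasure (CurveClass ℂ)) : Measure (CurveClass ℂ)) | ρ ∈ Set.range ν} := by
    refine htight.subset ?_
    rintro _ ⟨ρ, ⟨n, rfl⟩, rfl⟩
    exact ⟨s (n + N), (hN _ (N.le_add_left n)).2, rfl⟩
  -- Prokhorov and sequential compactness
  have hcomp := isCompact_closure_of_isTightMeasureSet htight'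
  obtain ⟨ρ, -, φ, hφ, hlim⟩ := hcomp.isSeqCompact fun n ↦ subset_closure (Set.mem_range_self n)
  refine ⟨fun n ↦ φ n + N, ρ, fun m n hmn ↦ Nat.add_lt_add_right (hφ hmn) N, inferInstance,
    fun f ↦ ?_⟩
  have := (ProbabilityMeasure.tendsto_iff_forall_integral_tendsto.1 hlim) f
  refine this.congr fun n ↦ ?_
  change ∫ x, f x ∂((SAW.law D.carrier (s (φ n + N)) (a (s (φ n + N))) (b (s (φ n + N)))).map
    (fun γ ↦ γ.curve)) = _
  exact integral_map (hmeas (φ n + N)) f.continuous.aestronglyMeasurable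

end SAWLoopFugacityFlowAssembly

/-! ### Step 5: the assembly -/

open SAWLoopFugacityFlowAssembly in
/-- **`SAWLoopFugacityFlow.Assembly` (stmt-CriticalPhenomena-10724) holds**:
`SLECarrier → SLEAvoidanceValue → AvoidanceLimit → EventualTight → SimpleSubseqLimits →
AvoidancePassage → AvoidanceDeterminesLaw → SAWScalingLimit`. Given the seven route items, for
every Dobrushin domain and endpoint approximation the critical SAW laws are eventually probability
measures and tight, every subsequential weak limit along a mesh sequence is identified with the
chordal SLE_{8/3} law `μ` (restriction values of hull subdomains + carriers + "avoidance
determines the law"), and the subsequence principle along `𝓝[>] 0` yields convergence in law to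
an SLE_{8/3} random curve with law `μ` (`ConvergesInLawToSLE (8/3) D`). LSW 2004 §3.4.2 / §4.1
Prediction 1 (programme), LSW 2003 §3 and Thm. 6.1 (restriction), Billingsley 1999 Thm. 5.1 and
Corollary (Prokhorov + subsequence principle). -/
theorem Assembly_proof :
    Summit.CriticalPhenomena.SAWScalingLimit.Theses.SAWLoopFugacityFlow.Assembly := by
  unfold Summit.CriticalPhenomena.SAWScalingLimit.Theses.SAWLoopFugacityFlow.Assembly
  intro hCar hVal hA hT hS hPass hDet D a b happ
  -- the chordal SLE_{8/3} law of `D`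
  obtain ⟨Γ, hΓ⟩ := exists_isSLECurve_eightThirds D
  have hμ : IsSLELaw ((8 : ℝ≥0) / 3) D (Process.preWienerMeasure.map Γ) := hΓ.isSLELaw_map
  refine ⟨Γ, hΓ, Eventually.of_forall fun δ ↦ SAW.aemeasurable_curve _ _ _ _, fun f ↦ ?_⟩
  -- subsequence principle along `𝓝[>] 0`
  refine tendsto_of_subseq_tendsto fun s hs ↦ ?_
  obtain ⟨φ, ν, hφ, hν, hlim⟩ := exists_subseq hT happ hs
  have hνμ : ν = Process.preWienerMeasure.map Γ :=
    subseqLimit_eq hCar hVal hA hS hPass hDet happ hμ (hs.comp hφ.tendsto_atTop) hν hlim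
  refine ⟨φ, ?_⟩
  have h := hlim f
  rw [hνμ, integral_map hΓ.aemeasurable f.continuous.aestronglyMeasurable] at h
  exact h

end Summit.CriticalPhenomena.SAWScalingLimit.Theorems

end
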